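import Summits.BirchSwinnertonDyer.BirchSwinnertonDyer.Theses.TwoAdicConverse
import Literature.NumberTheory.EllipticCurves.BSDSelmerPConverseYanZhuKolyvaginSystemProofs
import Literature.NumberTheory.EllipticCurves.BSDSelmerPConverse
import Literature.NumberTheory.EllipticCurves.NonvanishingTwistsBumpFriedbergHoffstein
import Literature.NumberTheory.EllipticCurves.BSDSelmerCMPConverseRankOneProofs
import Literature.NumberTheory.EllipticCurves.LeadingTerm
import HarnessLib

/-!
# Route `TwoAdicConverse` (rung S3): the KRR2-habitat split glue `RankOneTwoConverseGlue` PROVED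

LANDING TEMPLATE — elaborates only AFTER the operator has applied
`ledger route edit route-BirchSwinnertonDyer-TwoAdicConverse --split RankOneTwoConverse --into plan/children-19220.json …`
(RUNBOOK-19220-split.md step 1), which creates in `Theses/TwoAdicConverse.lean` the five children
`KolyvaginNonvanishingAtTwo` · `KolyvaginCorankRigidityAtTwo` · `RankOneTwoConverseOffBigImage` ·
`PrintedInputsRankOneAtTwo` · `NoTwoTorsionOverK` and the glue item
`RankOneTwoConverseGlue : Prop := KolyvaginNonvanishingAtTwo → KolyvaginCorankRigidityAtTwo →
RankOneTwoConverseOffBigImage → PrintedInputsRankOneAtTwo → NoTwoTorsionOverK → RankOneTwoConverse`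
(children in `--into` order; if the gate renders another order, permute the five `intro` names below).

The proof is the r = 1 branch of route KolyvaginRankRigidityAtTwo's certified `closes` (planner-bsd-idea-1-g2-0,
2026-08-28T01:07:12Z) re-targeted at the crux `RankOneTwoConverse`; it was kernel-checked BEFORE the split against
verbatim local copies of the children in `pub/bsd-2adic/plan/glue-19220.lean`
(`BSD2adicPlan.Split19220.rankOneTwoConverse_of_children`: lean rc 0, 0 sorry, axioms propext/Classical.choice/Quot.sound).
On the habitat (2-adic image surjective): 2-parity gives w(E) = −1; Hoffstein–Luo gives a Heegner field K with 2 split and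
L(E^(d_K),1) ≠ 0, so the partner has Sel-corank 0 (Kolyvagin–GZ finiteness); V1 gives a non-zero Kolyvagin class at 2,
V2 (corank rigidity at minimal depth) forces depth 0, i.e. y_K non-torsion; Gross–Zagier over K and the factorisation
L(E/K) = L(E)·L(E^(d_K)) give analytic rank 1. Off the habitat: the residual child, verbatim.
Nothing is assumed beyond the item's own statement. BSD is not proved by any of this; the children carry all the content.
-/

set_option autoImplicit false
set_option linter.dupNamespace false

namespace Summit.BirchSwinnertonDyer.BirchSwinnertonDyer.Theorems

open scoped BigOperators Classical
open Literature

open Summit.BirchSwinnertonDyer.BirchSwinnertonDyer.Theses.TwoAdicConverse in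
/-- **Item `RankOneTwoConverseGlue` of route `TwoAdicConverse` holds.** -/
theorem twoAdicConverse_rankOneTwoConverseGlue_proof :
    Summit.BirchSwinnertonDyer.BirchSwinnertonDyer.Theses.TwoAdicConverse.RankOneTwoConverseGlue := by
  unfold RankOneTwoConverseGlue
  intro hV1 hV2 hOff hIn hT
  unfold KolyvaginNonvanishingAtTwo at hV1
  unfold KolyvaginCorankRigidityAtTwo at hV2
  unfold RankOneTwoConverseOffBigImage at hOff
  unfold PrintedInputsRankOneAtTwo at hIn
  unfold NoTwoTorsionOverK at hT
  intro W _ _ hCM hred hc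
  by_cases hsur : (∀ m : ℕ, W.HasSurjectiveModNGaloisRep (2 ^ m : ℕ))
  swap
  · exact hOff W hCM hred hsur hc
  obtain ⟨hmod, hHL, hpar, hKato, hE, hGZ, hrec⟩ := hIn
  haveI : Fact (Nat.Prime 2) := ⟨Nat.prime_two⟩
  haveI : NeZero (W.conductorNorm ℤ) := ⟨(W.conductorNorm_pos_holds).ne'⟩
  -- root number −1 from 2-parity (Dokchitser–Dokchitser) and corank 1
  have hw : W.rootNumber = -1 := by
    have h := hpar W
    unfold Literature.NumberTheory.EllipticCurves.p_parity at h
    rw [hc, pow_one] at h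
    exact h.symm
  -- Heegner field K with 2 split, d_K ≡ 1 (mod 8), and L(E^(d_K), 1) ≠ 0 (Hoffstein–Luo)
  obtain ⟨K, _, _, hK, -, hHN, hH2, hd8, hL1⟩ :=
    Literature.NumberTheory.EllipticCurves.exists_heegnerField_split_twist_ne_zero_discr_emod_eight_of_hoffsteinLuo
      hmod hHL W hw Nat.prime_two 0
  have hodd : Odd (NumberField.discr K) := by
    rw [Int.odd_iff]; omega
  have hne3 : NumberField.discr K ≠ -3 := by omega
  have hne4 : NumberField.discr K ≠ -4 := by omega
  have h2d : ¬ ((2 : ℤ) ∣ NumberField.discr K) := by omega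
  have hd : (NumberField.discr K : ℚ) ≠ 0 := by exact_mod_cast NumberField.discr_ne_zero K
  haveI := W.isElliptic_quadraticTwist hd
  -- the partner twist has L(1) ≠ 0, hence (Kolyvagin–Gross–Zagier finiteness) 2-Selmer corank 0
  obtain ⟨-, -, hfin⟩ := hKato (W.quadraticTwist (NumberField.discr K : ℚ)) hL1
  haveI := hfin
  have hc' : (W.quadraticTwist (NumberField.discr K : ℚ)).selmerCorank 2 = 0 :=
    (W.quadraticTwist (NumberField.discr K : ℚ)).selmerCorank_eq_zero_of_finite 2
  have htor := hT W hsur K hK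
  -- V1: a non-zero Kolyvagin class at 2; take one of minimal depth
  obtain ⟨Dt, β, ι, n, d, M, hn, hM1, hMle, hne⟩ := hV1 W hCM hred hsur K hK hHN hodd hne3 htor hH2
  obtain ⟨n₀, d₀, M₀, hn₀, hM₀, hM₀le, hne₀, hmin⟩ :=
    Literature.NumberTheory.EllipticCurves.heegnerSystem_exists_minimal_kolyvaginClass_ne_zero
      Nat.prime_two d hn hM1 hMle hne
  -- V2: corank rigidity forces depth 0, i.e. the basic Heegner class y_K is non-torsion
  have hstruct := hV2 W hCM hred hsur K hK hne3 hne4 h2d hHN Dt β ι n₀ d₀ M₀ hn₀ hM₀ hM₀le hne₀ hmin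
  have hν : n₀.primeFactors.card = 0 := by
    rcases hstruct with ⟨h1, h2⟩ | ⟨h1, h2⟩ <;> omega
  have hn1 : n₀ = 1 := by
    rw [Finset.card_eq_zero, Nat.primeFactors_eq_empty] at hν
    rcases hν with h0 | h1
    · exact absurd (h0 ▸ hn₀.1) not_squarefree_zero
    · exact h1
  subst hn1
  -- Gross–Zagier over K: ord_(s=1) L(E/K, s) = 1, and L(E/K) = L(E) · L(E^(d_K)) with L(E^(d_K), 1) ≠ 0
  have hEK : Literature.NumberTheory.EllipticCurves.analyticRankEK W K = 1 :=
    Literature.NumberTheory.EllipticCurves.heegnerSystem_analyticRankEK_eq_one_of_kolyvaginClass_one_ne_zero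
      (hGZ W _ K) (hrec _ W K) hK rfl hHN d₀ hne₀
  rw [Literature.NumberTheory.EllipticCurves.analyticRankEK_eq_add_of hE W K,
    Literature.NumberTheory.EllipticCurves.analyticRank_eq_zero_of_entireLFunction_one_ne_zero _ hL1,
    add_zero] at hEK
  exact hEK

open Summit.BirchSwinnertonDyer.BirchSwinnertonDyer.Theses.TwoAdicConverse in
/-- The parent gives the residual child (drop the big-image negation): the split loses nothing on that side. -/
theorem twoAdicConverse_rankOneTwoConverseOffBigImage_of_rankOneTwoConverse
    (h : RankOneTwoConverse) : RankOneTwoConverseOffBigImage :=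
  fun W _ _ hcm hred _ hc => h W hcm hred hc

end Summit.BirchSwinnertonDyer.BirchSwinnertonDyer.Theorems
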